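import Summits.NavierStokesRegularity.OSWSelfSimilar.SheetRResolventOddClass
import HarnessLib

/-!
# SHEET-ℝ frame, (P1) for the FULL operator `A = (−∂² + d∂ + V) + K`: the closed operator `T` on the odd class IS `−A` in the weak sense —
# form characterisation of `D(T)` and of `T u`

HONEST FRAMING (cell ns-blowup GROUP B / zone Z3, case Z3-SR-SPEC, PAPER item (P1) and the resolvent-keyed eigenvalue dictionary; 1-D MODEL
certificate frame (viscous gCLM/OSW sheet on the line); not Euler/NS; «violates: none — MODEL»). Nothing here asserts that a profile exists; the
Gårding datum of the perturbed form ((S1), interval arithmetic) is the HYPOTHESIS `GardingDataKC`; `K : Esp L hL →L[ℝ] W L` is arbitrary bounded.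

`SheetRResolventOddClass.generatorOdd hL K h σ₀ hσ₀ = T` is Kato's closed operator with `R_K(σ) = (σ − T)⁻¹` on the odd class `Wcodd L`,
obtained ABSTRACTLY from the injective pseudo-resolvent.  This file identifies it with the differential operator: writing
`IsWeakImage hL K d V P F` for «the energy-space pair `P = (p_R, p_I)` solves the UNSHIFTED perturbed system with complex datum `F`», i.e.
`linForm_V(u_R; v) + ∫ w (K p_R) v = ∫ w (Re F) v` and `linForm_V(u_I; v) + ∫ w (K p_I) v = ∫ w (Im F) v` on every compactly supported odd
energy-class test (`u_• = prim (der p_•)`; «`A(u_R + iu_I) = F` weakly»):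

* `shifted_iff` — the `σ`-shifted pair system with datum `G = F + σu` is equivalent to the unshifted one with datum `F` (potential shift);
* **`weak_of_mem_domain`** — if `u ∈ D(T)` then `u = u_R + iu_I` with an energy-space pair `P` (`toPair u = ιpair P`) and `A(u_R + iu_I) = −Tu` weakly;
* **`mem_domain_of_weak`** — conversely, if `u ∈ Wcodd` has energy-space coordinates `P` and `A(u_R + iu_I) = F` weakly with `F ∈ Wcodd`, then
  `u ∈ D(T)` and `Tu = −F`.
So `D(T) = {u ∈ L²_{w,odd}(ℂ) : Re u, Im u ∈ E, A u ∈ L²_w weakly}` and `T = −A` there — independently of the base point `σ₀`; in the cell's notation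
`T = −A_F` on the odd class, the operator whose eigenvalues the spectral certificate (S2)/(S3) counts.
One definition (`IsWeakImage`, a `Prop`); no named fact.  WHAT THIS IS NOT: not NS; not the spectral certificate; no number of record moves.
-/

noncomputable section

namespace Summit.NavierStokesRegularity.OSWSelfSimilar
namespace SheetRGeneratorOddWeak

open _root_.MeasureTheory _root_.Set _root_.Filter _root_.Real SheetRWeakProfilePV SheetRWeakToStrong SheetREnergyClass SheetRWeightedMeasure
  SheetRLinearisedTests SheetREnergySpace SheetRTestSpace SheetRLinearisedFormBounds SheetRSolutionOperator SheetRLinearisedCutoffEnergy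
  SheetRResolventPair SheetRComplexPivot SheetRResolventComplex SheetRResolventIdentity SheetRPerturbedUniqueness SheetRPerturbedPair
  SheetRPerturbedResolventC SheetRPerturbedResolventIdentityC SheetROddClass SheetRResolventOddClass Literature.Analysis.OperatorTheory
open scoped Topology ENNReal

variable {L D₀ D₁ V₀ c m : ℝ} {d V : ℝ → ℝ}

/-! ### §1 The unshifted weak system with a complex datum -/

/-- **`A(u_R + iu_I) = F` weakly**: the energy-space pair `P = (p_R, p_I)` solves the UNSHIFTED perturbed system with complex datum `F`,
`linForm_V(u_R; v) + ∫ w (K p_R) v = ∫ w (Re F) v`, `linForm_V(u_I; v) + ∫ w (K p_I) v = ∫ w (Im F) v` on every compactly supported odd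
energy-class test. [folklore] -/
def IsWeakImage (hL : 0 < L) (K : Esp L hL →L[ℝ] W L) (d V : ℝ → ℝ) (P : WithLp 2 (Esp L hL × Esp L hL)) (F : Wc L) : Prop :=
  ∀ v v₁ : ℝ → ℝ, IsCompactTest v v₁ →
    linForm L d V (prim (der P.fst)) (der P.fst) v v₁ + (∫ y, (L ^ 2 + y ^ 2) * (((K P.fst : W L) : ℝ → ℝ) y * v y)) =
        ∫ y, (L ^ 2 + y ^ 2) * (((reW L F : W L) : ℝ → ℝ) y * v y) ∧
      linForm L d V (prim (der P.snd)) (der P.snd) v v₁ + (∫ y, (L ^ 2 + y ^ 2) * (((K P.snd : W L) : ℝ → ℝ) y * v y)) =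
        ∫ y, (L ^ 2 + y ^ 2) * (((imW L F : W L) : ℝ → ℝ) y * v y)

/-- **Potential shift with complex datum.**  If `Re G = Re σ·u_R − Im σ·u_I + Re F` and `Im G = Re σ·u_I + Im σ·u_R + Im F` a.e., then the
`σ`-shifted pair system with datum `G` holds at a test iff the unshifted one with datum `F` does. [folklore] -/
theorem shifted_iff (hL : 0 < L) (K : Esp L hL →L[ℝ] W L) (h : GardingDataKC L hL d V K D₀ D₁ V₀ c m) (σ : ℂ)
    (P : WithLp 2 (Esp L hL × Esp L hL)) (F G : Wc L)
    (hre : ((reW L G : W L) : ℝ → ℝ) =ᵐ[volume] fun y =>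
      σ.re * prim (der P.fst) y - σ.im * prim (der P.snd) y + ((reW L F : W L) : ℝ → ℝ) y)
    (him : ((imW L G : W L) : ℝ → ℝ) =ᵐ[volume] fun y =>
      σ.re * prim (der P.snd) y + σ.im * prim (der P.fst) y + ((imW L F : W L) : ℝ → ℝ) y)
    (v v₁ : ℝ → ℝ) (hv : IsCompactTest v v₁) :
    (linForm L d (fun ξ => V ξ + σ.re) (prim (der P.fst)) (der P.fst) v v₁
            + (∫ y, (L ^ 2 + y ^ 2) * (((K P.fst : W L) : ℝ → ℝ) y * v y))
            - σ.im * ∫ y, (L ^ 2 + y ^ 2) * (prim (der P.snd) y * v y) = ∫ y, (L ^ 2 + y ^ 2) * (((reW L G : W L) : ℝ → ℝ) y * v y) ∧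
        linForm L d (fun ξ => V ξ + σ.re) (prim (der P.snd)) (der P.snd) v v₁
            + (∫ y, (L ^ 2 + y ^ 2) * (((K P.snd : W L) : ℝ → ℝ) y * v y))
            + σ.im * ∫ y, (L ^ 2 + y ^ 2) * (prim (der P.fst) y * v y) = ∫ y, (L ^ 2 + y ^ 2) * (((imW L G : W L) : ℝ → ℝ) y * v y)) ↔
      (linForm L d V (prim (der P.fst)) (der P.fst) v v₁ + (∫ y, (L ^ 2 + y ^ 2) * (((K P.fst : W L) : ℝ → ℝ) y * v y)) =
          ∫ y, (L ^ 2 + y ^ 2) * (((reW L F : W L) : ℝ → ℝ) y * v y) ∧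
        linForm L d V (prim (der P.snd)) (der P.snd) v v₁ + (∫ y, (L ^ 2 + y ^ 2) * (((K P.snd : W L) : ℝ → ℝ) y * v y)) =
          ∫ y, (L ^ 2 + y ^ 2) * (((imW L F : W L) : ℝ → ℝ) y * v y)) := by
  obtain ⟨humR, hu₁mR, h0R, h1R, -, -⟩ := profile_facts hL P.fst
  obtain ⟨humI, hu₁mI, h0I, h1I, -, -⟩ := profile_facts hL P.snd
  obtain ⟨hiR, hzR⟩ := linForm_shiftKC h σ.re hv humR hu₁mR h0R h1R
  obtain ⟨hiI, hzI⟩ := linForm_shiftKC h σ.re hv humI hu₁mI h0I h1I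
  have hiF1 := integrable_weight_mul_test hL (reW L F) hv
  have hiF2 := integrable_weight_mul_test hL (imW L F) hv
  have hdat1 : ∫ y, (L ^ 2 + y ^ 2) * (((reW L G : W L) : ℝ → ℝ) y * v y) =
      σ.re * (∫ y, (L ^ 2 + y ^ 2) * (prim (der P.fst) y * v y)) - σ.im * (∫ y, (L ^ 2 + y ^ 2) * (prim (der P.snd) y * v y))
        + ∫ y, (L ^ 2 + y ^ 2) * (((reW L F : W L) : ℝ → ℝ) y * v y) := by
    have e : ∫ y, (L ^ 2 + y ^ 2) * (((reW L G : W L) : ℝ → ℝ) y * v y) =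
        ∫ y, (σ.re * ((L ^ 2 + y ^ 2) * (prim (der P.fst) y * v y)) - σ.im * ((L ^ 2 + y ^ 2) * (prim (der P.snd) y * v y))
          + (L ^ 2 + y ^ 2) * (((reW L F : W L) : ℝ → ℝ) y * v y)) := by
      refine integral_congr_ae ?_
      filter_upwards [hre] with y hy
      rw [hy]; ring
    have hI12 : Integrable (fun y => σ.re * ((L ^ 2 + y ^ 2) * (prim (der P.fst) y * v y))
        - σ.im * ((L ^ 2 + y ^ 2) * (prim (der P.snd) y * v y))) := (hiR.const_mul _).sub (hiI.const_mul _)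
    rw [e, integral_add hI12 hiF1, integral_sub (hiR.const_mul _) (hiI.const_mul _), integral_const_mul, integral_const_mul]
  have hdat2 : ∫ y, (L ^ 2 + y ^ 2) * (((imW L G : W L) : ℝ → ℝ) y * v y) =
      σ.re * (∫ y, (L ^ 2 + y ^ 2) * (prim (der P.snd) y * v y)) + σ.im * (∫ y, (L ^ 2 + y ^ 2) * (prim (der P.fst) y * v y))
        + ∫ y, (L ^ 2 + y ^ 2) * (((imW L F : W L) : ℝ → ℝ) y * v y) := by
    have e : ∫ y, (L ^ 2 + y ^ 2) * (((imW L G : W L) : ℝ → ℝ) y * v y) =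
        ∫ y, (σ.re * ((L ^ 2 + y ^ 2) * (prim (der P.snd) y * v y)) + σ.im * ((L ^ 2 + y ^ 2) * (prim (der P.fst) y * v y))
          + (L ^ 2 + y ^ 2) * (((imW L F : W L) : ℝ → ℝ) y * v y)) := by
      refine integral_congr_ae ?_
      filter_upwards [him] with y hy
      rw [hy]; ring
    have hI12 : Integrable (fun y => σ.re * ((L ^ 2 + y ^ 2) * (prim (der P.snd) y * v y))
        + σ.im * ((L ^ 2 + y ^ 2) * (prim (der P.fst) y * v y))) := (hiI.const_mul _).add (hiR.const_mul _)
    rw [e, integral_add hI12 hiF2, integral_add (hiI.const_mul _) (hiR.const_mul _), integral_const_mul, integral_const_mul]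
  rw [hzR, hzI, hdat1, hdat2]
  constructor
  · rintro ⟨e1, e2⟩
    exact ⟨by linarith, by linarith⟩
  · rintro ⟨e1, e2⟩
    exact ⟨by linarith, by linarith⟩

/-- The energy-space coordinates of `u` give its real and imaginary parts a.e.: `toPair u = ιpair P ⇒ Re u = u_R, Im u = u_I` a.e. [folklore] -/
theorem re_im_ae_of_toPair (hL : 0 < L) {u : Wc L} {P : WithLp 2 (Esp L hL × Esp L hL)} (hP : toPair L u = ιpair hL P) :
    (((reW L u : W L) : ℝ → ℝ) =ᵐ[volume] prim (der P.fst)) ∧ (((imW L u : W L) : ℝ → ℝ) =ᵐ[volume] prim (der P.snd)) := by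
  obtain ⟨h1, h2⟩ := toPair_fst_snd u
  obtain ⟨hi1, hi2⟩ := ιpair_fst_snd hL P
  rw [← h1, ← h2, hP, hi1, hi2]
  exact ⟨ιE_ae hL P.fst, ιE_ae hL P.snd⟩

/-- The a.e. coordinates of `F + σ·u` when `toPair u = ιpair P`. [folklore] -/
theorem data_ae (hL : 0 < L) (σ : ℂ) {u : Wc L} {P : WithLp 2 (Esp L hL × Esp L hL)} (hP : toPair L u = ιpair hL P) (F : Wc L) :
    (((reW L (F + σ • u) : W L) : ℝ → ℝ) =ᵐ[volume] fun y =>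
        σ.re * prim (der P.fst) y - σ.im * prim (der P.snd) y + ((reW L F : W L) : ℝ → ℝ) y) ∧
      (((imW L (F + σ • u) : W L) : ℝ → ℝ) =ᵐ[volume] fun y =>
        σ.re * prim (der P.snd) y + σ.im * prim (der P.fst) y + ((imW L F : W L) : ℝ → ℝ) y) := by
  obtain ⟨hdre, hdim⟩ := reW_imW_add_smul_ae hL F u σ
  obtain ⟨hr, hi⟩ := re_im_ae_of_toPair hL hP
  constructor
  · filter_upwards [hdre, hr, hi] with y hy hyr hyi
    rw [hy, hyr, hyi]; ring
  · filter_upwards [hdim, hr, hi] with y hy hyr hyi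
    rw [hy, hyr, hyi]; ring

/-! ### §2 `D(T) ⊆ {A u ∈ L²_w}` and `T = −A` on it -/

/-- **Elements of `D(T)` are weak preimages**: if `u ∈ D(T)` then `u` has energy-space coordinates `P` (`toPair u = ιpair P`) and
`A(u_R + iu_I) = −Tu` weakly. [folklore] -/
theorem weak_of_mem_domain (hL : 0 < L) (K : Esp L hL →L[ℝ] W L) (h : GardingDataKC L hL d V K D₀ D₁ V₀ c m) {σ₀ : ℂ} (hσ₀ : -m < σ₀.re)
    {u : Wcodd L} (hu : u ∈ (generatorOdd hL K h σ₀ hσ₀).domain) :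
    ∃ P : WithLp 2 (Esp L hL × Esp L hL), toPair L (u : Wc L) = ιpair hL P ∧
      IsWeakImage hL K d V P (-((generatorOdd hL K h σ₀ hσ₀ ⟨u, hu⟩ : Wcodd L) : Wc L)) := by
  obtain ⟨G₀, hG₀, hT⟩ := exists_eq_apply_of_mem_domain (J := resolventOdd hL K h) (hinj := injective_resolventOdd hL K h hσ₀) hu
  have hT' : generatorOdd hL K h σ₀ hσ₀ ⟨u, hu⟩ = σ₀ • u - G₀ := hT
  obtain ⟨happ, -, -, hweak⟩ := resolventKC_weak hL K h hσ₀ (G₀ : Wc L)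
  set P := pairOpKC hL K h σ₀ hσ₀ (toPair L (G₀ : Wc L)) with hPdef
  have hu_eq : (u : Wc L) = resolventKC hL K h σ₀ (G₀ : Wc L) := by rw [← coe_resolventOdd, hG₀]
  have hP : toPair L (u : Wc L) = ιpair hL P := by rw [hu_eq, happ, toPair_ofPair]
  have hG₀eq : (G₀ : Wc L) = -((generatorOdd hL K h σ₀ hσ₀ ⟨u, hu⟩ : Wcodd L) : Wc L) + σ₀ • (u : Wc L) := by
    have e : ((generatorOdd hL K h σ₀ hσ₀ ⟨u, hu⟩ : Wcodd L) : Wc L) = σ₀ • (u : Wc L) - (G₀ : Wc L) := by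
      rw [hT', Submodule.coe_sub, Submodule.coe_smul]
    rw [e]
    abel
  obtain ⟨hre, him⟩ := data_ae hL σ₀ hP (-((generatorOdd hL K h σ₀ hσ₀ ⟨u, hu⟩ : Wcodd L) : Wc L))
  rw [← hG₀eq] at hre him
  exact ⟨P, hP, fun v v₁ hv =>
    (shifted_iff hL K h σ₀ P (-((generatorOdd hL K h σ₀ hσ₀ ⟨u, hu⟩ : Wcodd L) : Wc L)) (G₀ : Wc L) hre him v v₁ hv).1 (hweak v v₁ hv)⟩

/-! ### §3 `{A u ∈ L²_w} ⊆ D(T)` and `Tu = −Au` -/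

/-- **Weak preimages are in `D(T)`**: if `u ∈ Wcodd` has energy-space coordinates `P` and `A(u_R + iu_I) = F` weakly with `F ∈ Wcodd`, then
`u ∈ D(T)` and `Tu = −F`. [folklore] -/
theorem mem_domain_of_weak (hL : 0 < L) (K : Esp L hL →L[ℝ] W L) (h : GardingDataKC L hL d V K D₀ D₁ V₀ c m) {σ₀ : ℂ} (hσ₀ : -m < σ₀.re)
    {u F : Wcodd L} {P : WithLp 2 (Esp L hL × Esp L hL)} (hP : toPair L (u : Wc L) = ιpair hL P) (hw : IsWeakImage hL K d V P (F : Wc L)) :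
    ∃ hu : u ∈ (generatorOdd hL K h σ₀ hσ₀).domain, generatorOdd hL K h σ₀ hσ₀ ⟨u, hu⟩ = -F := by
  set G : Wcodd L := F + σ₀ • u with hGdef
  have hGc : (G : Wc L) = (F : Wc L) + σ₀ • (u : Wc L) := by rw [hGdef, Submodule.coe_add, Submodule.coe_smul]
  obtain ⟨hre, him⟩ := data_ae hL σ₀ hP (F : Wc L)
  rw [← hGc] at hre him
  -- `P` solves the `σ₀`-system with datum `toPair G`, hence is `pairOpKC σ₀ (toPair G)`
  have hsolves : ∀ v v₁ : ℝ → ℝ, IsCompactTest v v₁ →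
      linForm L d (fun ξ => V ξ + σ₀.re) (prim (der P.fst)) (der P.fst) v v₁
            + (∫ y, (L ^ 2 + y ^ 2) * (((K P.fst : W L) : ℝ → ℝ) y * v y))
            - σ₀.im * ∫ y, (L ^ 2 + y ^ 2) * (prim (der P.snd) y * v y) =
          ∫ y, (L ^ 2 + y ^ 2) * ((((toPair L (G : Wc L)).fst : W L) : ℝ → ℝ) y * v y) ∧
        linForm L d (fun ξ => V ξ + σ₀.re) (prim (der P.snd)) (der P.snd) v v₁
            + (∫ y, (L ^ 2 + y ^ 2) * (((K P.snd : W L) : ℝ → ℝ) y * v y))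
            + σ₀.im * ∫ y, (L ^ 2 + y ^ 2) * (prim (der P.fst) y * v y) =
          ∫ y, (L ^ 2 + y ^ 2) * ((((toPair L (G : Wc L)).snd : W L) : ℝ → ℝ) y * v y) := by
    intro v v₁ hv
    rw [(toPair_fst_snd (G : Wc L)).1, (toPair_fst_snd (G : Wc L)).2]
    exact (shifted_iff hL K h σ₀ P (F : Wc L) (G : Wc L) hre him v v₁ hv).2 (hw v v₁ hv)
  have hPeq := pairOpKC_unique hL K h σ₀ hσ₀ (toPair L (G : Wc L)) hsolves
  have hRG : resolventKC hL K h σ₀ (G : Wc L) = (u : Wc L) := by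
    obtain ⟨happ, -, -, -⟩ := resolventKC_weak hL K h hσ₀ (G : Wc L)
    rw [happ, ← hPeq, ← hP, ofPair_toPair]
  have hJ : resolventOdd hL K h σ₀ G = u := Subtype.ext hRG
  have hu : u ∈ (generatorOdd hL K h σ₀ hσ₀).domain := by
    rw [generatorOdd_domain]
    exact ⟨G, hJ⟩
  refine ⟨hu, ?_⟩
  have hT := generatorOdd_resolventOdd hL K h hσ₀ hσ₀ G
  have heq : (⟨resolventOdd hL K h σ₀ G, resolventOdd_mem_domain hL K h hσ₀ hσ₀ G⟩ : (generatorOdd hL K h σ₀ hσ₀).domain) = ⟨u, hu⟩ :=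
    Subtype.ext hJ
  rw [heq, hJ] at hT
  rw [hT, hGdef]
  abel

/-- **The domain does not depend on the base point and `T = −A` there** (packaged): `u ∈ D(T)` iff `u` has energy-space coordinates with a weak
image in the odd class. [folklore] -/
theorem mem_domain_iff (hL : 0 < L) (K : Esp L hL →L[ℝ] W L) (h : GardingDataKC L hL d V K D₀ D₁ V₀ c m) {σ₀ : ℂ} (hσ₀ : -m < σ₀.re)
    (u : Wcodd L) :
    u ∈ (generatorOdd hL K h σ₀ hσ₀).domain ↔
      ∃ (P : WithLp 2 (Esp L hL × Esp L hL)) (F : Wcodd L), toPair L (u : Wc L) = ιpair hL P ∧ IsWeakImage hL K d V P (F : Wc L) := by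
  constructor
  · intro hu
    obtain ⟨P, hP, hw⟩ := weak_of_mem_domain hL K h hσ₀ hu
    refine ⟨P, -generatorOdd hL K h σ₀ hσ₀ ⟨u, hu⟩, hP, ?_⟩
    rw [Submodule.coe_neg]
    exact hw
  · rintro ⟨P, F, hP, hw⟩
    exact (mem_domain_of_weak hL K h hσ₀ hP hw).1

end SheetRGeneratorOddWeak
end Summit.NavierStokesRegularity.OSWSelfSimilar

end
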